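import Mathlib.Analysis.Calculus.Deriv.MeanValue
import Mathlib.Analysis.SpecialFunctions.Sqrt
import Literature.Probability.Percolation.MooreShannonInfluenceBound
import Literature.Probability.Percolation.SharpnessDCTProofs
import Literature.Probability.Percolation.ArmEvents
import Summits.CriticalPhenomena.PercolationContinuityZ3.Theorems.PercNearOneGluingNoHeavyLowerTailCSHTheoremOne
import HarnessLib

/-!
# Modulus of continuity of `θ` at `p_c⁺` from the one-arm probabilities at `p_c`, and
# (one-arm polynomial decay at `p_c`) ⇒ (explicit Hölder modulus) — quant lane, rung R4

builds on p205010 (kernel theorem, internal audit signed; external expert review pending).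
Status sentence for p205010: "θ(p_c) = 0 on ℤ^d, all d ≥ 2 — kernel-verified (Lean 4/Mathlib, standard
axioms); internal adversarial audit SIGNED 2026-08-20 04:29Z; external expert review pending."

Seat `prim-quant-p4` (METHOD = differential inequalities for `θ` near `p_c`), helper file
`--supports stmt-CriticalPhenomena-4575`.  Pure proofs, no definitions (the edge window `ℰ(d, n)` below is
shorthand IN PROSE ONLY for `(box d n).sym2.filter (· ∈ (zdGraph d).edgeSet)`), no named-fact hypotheses except the explicit one-arm DECAY hypothesis of §6, which is
the open conjecture (T1) (for `d = 3`: `Literature.StrongHypotheses.CriticalPhenomena.CriticalOneArmPolyDecayZ3`).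

## The argument (sources: PRINTED unless marked OURS)

Write `θ_n(p) = π_p(n) = P_p(0 ↔ ∂Λ_n)` (`DCT16.thetaN`, `oneArmProb`), `Λ_n = [-n, n]^d`, `ℰ(d, n)` the
edges of `ℤ^d` inside `Λ_n` (`#ℰ(d, n) ≤ 2d(2n+1)^d`, `card_boxEdges_le`).

1. PRINTED (Grimmett 1999, Thm. (2.36)(a) = Moore–Shannon 1956 / Chayes–Chayes–Fisher–Spencer 1986;
   tree: `Literature.Probability.Percolation.exists_hasDerivAt_real_le_sqrt`, from Russo's formula
   `russo_formula_sum_holds` and the level-1 inequality `prodBernoulli_levelOne_le`):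
   `θ_n'(r) ≤ √( #ℰ · θ_n(r)(1 − θ_n(r)) / (r(1 − r)) )` on `(0, 1)`.
2. OURS (calculus, `sqrt_le_sqrt_add_of_deriv_le`, `sqrt_thetaN_le`): hence `(√θ_n)' ≤ ½ √(#ℰ/(q(1−p)))` on
   `[q, p]`, i.e. `√θ_n(p) ≤ √θ_n(q) + ((p − q)/2) √( #ℰ(d,n) / (q(1 − p)) )` for `0 < q ≤ p < 1`.
3. PRINTED (Grimmett 1999 §1.4; tree `DCT16.theta_le_real_siteToBoundary`): `θ(p) ≤ θ_n(p)`.  Hence (OURS,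
   `theta_le_sq_sqrt_oneArm_add`, `theta_le_sq_sqrt_oneArm_critical`, `theta_le_ciInf_critical`): for
   `d ≥ 2` and `p_c ≤ p ≤ (1 + p_c)/2`,
   `θ(p) ≤ ω_d(p − p_c)`, `ω_d(t) := inf_n ( √π_{p_c}(n) + t · √( #ℰ(d,n) / (2 p_c (1 − p_c)) ) )²`.
4. p205010 (`CSH.percolationContinuity_allDimensions`: `θ(p_c) = 0`, equivalently `inf_n π_{p_c}(n) = 0`)
   gives `ω_d(t) → 0` as `t → 0` (`tendsto_ciInf_critical`): `ω_d` IS a modulus of continuity of `θ` at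
   `p_c⁺`, explicit modulo the critical one-arm sequence `(π_{p_c}(n))_n` — and modulo nothing else.
5.–6. (companion file `PercNearOneGluingNoHeavyQuantThetaHolderOfOneArm.lean`) CONDITIONAL (T1) ⇒ (T2): if
   `π_{p_c}(n) ≤ C n^{−c}` then `θ(p) ≤ K · (p − p_c)^{2c/(c+d)}` with `K` explicit, and the comparison with
   the printed mean-field lower bound `θ(p) ≥ p − p_c` (tree `sub_criticalProb_le_theta`).

Honest scope.  No rate is proved here: (T1) is open in print and in the tree for `3 ≤ d ≤ 6`
(QUANT.md §6; POSTCONT-LITERATURE.md §B), and without a rate `ω_d` is explicit only through the numbers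
`π_{p_c}(n)`.  What this file settles is the lane's rung R4: (T2) is a COROLLARY of any explicit
critical one-arm rate, with the exponent `2c/(c+d)` and all constants explicit, kernel-checked.

## References
* G. Grimmett, *Percolation*, 2nd ed. (1999), Thm. (2.36)(a), (2.31), §1.4 [GrimmettPercolation1999].
* J. T. Chayes, L. Chayes, D. S. Fisher, T. Spencer, Phys. Rev. Lett. 57 (1986) 2999 (`ν ≥ 2/d`).
* H. Duminil-Copin, V. Tassion, L'Enseignement Math. 62 (2016) 199–206, Thm. 1.1(2) [DuminilCopinTassionEM2016].
* M. Aizenman, D. J. Barsky, Comm. Math. Phys. 108 (1987) 489–526 (mean-field bound `β ≤ 1`).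
-/

noncomputable section

namespace Summit.CriticalPhenomena.PercolationContinuityZ3.Theorems

namespace ThetaModulus

open MeasureTheory Set Filter Topology Literature.Probability.Percolation Literature.Probability.LatticeModels
open scoped Classical

/-! ### §1. Calculus: integrating `g' ≤ M √g` -/

/-- `√(x + ε) ≤ √x + √ε` for `x, ε ≥ 0`. [folklore] -/
theorem sqrt_add_le_sqrt_add_sqrt {x ε : ℝ} (hx : 0 ≤ x) (hε : 0 ≤ ε) :
    Real.sqrt (x + ε) ≤ Real.sqrt x + Real.sqrt ε := by
  rw [Real.sqrt_le_left (by positivity)]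
  nlinarith [Real.sq_sqrt hx, Real.sq_sqrt hε, Real.sqrt_nonneg x, Real.sqrt_nonneg ε]

/-- **Square-root comparison.** If `g ≥ 0` is continuous on `[a, b]` and differentiable on `(a, b)` with
`g' ≤ M √g` (`M ≥ 0`), then `√(g b) ≤ √(g a) + (M/2)(b − a)` (since `(√(g + ε))' ≤ M/2` for every
`ε > 0`). [folklore] -/
theorem sqrt_le_sqrt_add_of_deriv_le {g : ℝ → ℝ} {a b M : ℝ} (hab : a ≤ b) (hM : 0 ≤ M)
    (hcont : ContinuousOn g (Icc a b)) (hg0 : ∀ x ∈ Icc a b, 0 ≤ g x)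
    (hder : ∀ x ∈ Ioo a b, ∃ D, HasDerivAt g D x ∧ D ≤ M * Real.sqrt (g x)) :
    Real.sqrt (g b) ≤ Real.sqrt (g a) + M / 2 * (b - a) := by
  -- for every `ε > 0`: `√(g b + ε) ≤ √(g a + ε) + (M/2)(b - a)`
  have key : ∀ ε : ℝ, 0 < ε → Real.sqrt (g b + ε) ≤ Real.sqrt (g a + ε) + M / 2 * (b - a) := by
    intro ε hε
    set h : ℝ → ℝ := fun x => Real.sqrt (g x + ε) - M / 2 * x with hh
    have hanti : AntitoneOn h (Icc a b) := by
      apply antitoneOn_of_deriv_nonpos (convex_Icc a b)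
      · exact ((hcont.add continuousOn_const).sqrt).sub (continuousOn_const.mul continuousOn_id)
      · rw [interior_Icc]
        intro x hx
        obtain ⟨D, hD, -⟩ := hder x hx
        have hpos : g x + ε ≠ 0 := (add_pos_of_nonneg_of_pos (hg0 x (Ioo_subset_Icc_self hx)) hε).ne'
        exact (((hD.add_const ε).sqrt hpos).sub ((hasDerivAt_id x).const_mul (M / 2))).differentiableAt.differentiableWithinAt
      · rw [interior_Icc]
        intro x hx
        obtain ⟨D, hD, hDle⟩ := hder x hx
        have hgx : 0 ≤ g x := hg0 x (Ioo_subset_Icc_self hx)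
        have hpos' : 0 < g x + ε := add_pos_of_nonneg_of_pos hgx hε
        have hderiv : HasDerivAt h (D / (2 * Real.sqrt (g x + ε)) - M / 2 * 1) x :=
          ((hD.add_const ε).sqrt hpos'.ne').sub ((hasDerivAt_id x).const_mul (M / 2))
        rw [hderiv.deriv]
        have hs : 0 < Real.sqrt (g x + ε) := Real.sqrt_pos.2 hpos'
        have hsg : Real.sqrt (g x) ≤ Real.sqrt (g x + ε) := Real.sqrt_le_sqrt (by linarith)
        have h1 : D / (2 * Real.sqrt (g x + ε)) ≤ M / 2 := by
          rw [div_le_iff₀ (by positivity)]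
          calc D ≤ M * Real.sqrt (g x) := hDle
            _ ≤ M * Real.sqrt (g x + ε) := mul_le_mul_of_nonneg_left hsg hM
            _ = M / 2 * (2 * Real.sqrt (g x + ε)) := by ring
        linarith
    have hab' := hanti (left_mem_Icc.2 hab) (right_mem_Icc.2 hab) hab
    simp only [hh] at hab'
    linarith
  -- let `ε → 0`
  refine le_of_forall_pos_le_add fun δ hδ => ?_
  have hga : 0 ≤ g a := hg0 a (left_mem_Icc.2 hab)
  have hgb : 0 ≤ g b := hg0 b (right_mem_Icc.2 hab)
  calc Real.sqrt (g b) ≤ Real.sqrt (g b + δ ^ 2) := Real.sqrt_le_sqrt (by nlinarith)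
    _ ≤ Real.sqrt (g a + δ ^ 2) + M / 2 * (b - a) := key (δ ^ 2) (by positivity)
    _ ≤ Real.sqrt (g a) + Real.sqrt (δ ^ 2) + M / 2 * (b - a) := by
        have := sqrt_add_le_sqrt_add_sqrt hga (sq_nonneg δ); linarith
    _ = Real.sqrt (g a) + M / 2 * (b - a) + δ := by rw [Real.sqrt_sq hδ.le]; ring

/-! ### §2. The number of edges of `ℤ^d` inside the box `Λ_n` -/

variable {d : ℕ}

/-- `#E(Λ_n) ≤ 2d (2n+1)^d`: every edge inside `Λ_n` is `{x, y}` with `x ∈ Λ_n` and `y` one of the `2d`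
neighbours of `x`. [folklore] -/
theorem card_boxEdges_le (d n : ℕ) : ((box d n).sym2.filter (· ∈ (zdGraph d).edgeSet)).card ≤ 2 * d * (2 * n + 1) ^ d := by
  classical
  have hsub : ((box d n).sym2.filter (· ∈ (zdGraph d).edgeSet)) ⊆ (box d n).biUnion
      (fun x => ((zdGraph d).neighborFinset x).image (fun y => s(x, y))) := by
    intro e he
    rw [Finset.mem_filter] at he
    obtain ⟨hbox, hE⟩ := he
    induction e using Sym2.ind with
    | h x y =>
      rw [Finset.mem_biUnion]
      refine ⟨x, Finset.mem_sym2_iff.1 hbox x (Sym2.mem_mk_left x y), ?_⟩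
      rw [Finset.mem_image]
      exact ⟨y, (SimpleGraph.mem_neighborFinset _ _ _).2 ((SimpleGraph.mem_edgeSet _).1 hE), rfl⟩
  calc ((box d n).sym2.filter (· ∈ (zdGraph d).edgeSet)).card
      ≤ ((box d n).biUnion (fun x => ((zdGraph d).neighborFinset x).image (fun y => s(x, y)))).card :=
        Finset.card_le_card hsub
    _ ≤ ∑ x ∈ box d n, (((zdGraph d).neighborFinset x).image (fun y => s(x, y))).card :=
        Finset.card_biUnion_le
    _ ≤ ∑ x ∈ box d n, 2 * d := Finset.sum_le_sum fun x _ =>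
        (Finset.card_image_le).trans (card_neighborFinset_zdGraph_holds x).le
    _ = 2 * d * (2 * n + 1) ^ d := by
        rw [Finset.sum_const, card_box, smul_eq_mul]; ring

/-- The cruder monomial bound `#E(Λ_n) ≤ 2d·3^d·n^d` for `n ≥ 1`. [folklore] -/
theorem card_boxEdges_le_pow (d : ℕ) {n : ℕ} (hn : 1 ≤ n) :
    (((box d n).sym2.filter (· ∈ (zdGraph d).edgeSet)).card : ℝ) ≤ 2 * d * 3 ^ d * (n : ℝ) ^ d := by
  have h1 : (((box d n).sym2.filter (· ∈ (zdGraph d).edgeSet)).card : ℝ) ≤ 2 * d * (2 * n + 1) ^ d := by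
    exact_mod_cast card_boxEdges_le d n
  have h2 : ((2 * n + 1 : ℕ) : ℝ) ^ d ≤ (3 * n : ℝ) ^ d := by
    apply pow_le_pow_left₀ (by positivity)
    have : (1 : ℝ) ≤ n := by exact_mod_cast hn
    push_cast; linarith
  calc (((box d n).sym2.filter (· ∈ (zdGraph d).edgeSet)).card : ℝ) ≤ 2 * d * ((2 * n + 1 : ℕ) : ℝ) ^ d := by exact_mod_cast card_boxEdges_le d n
    _ ≤ 2 * d * (3 * n : ℝ) ^ d := mul_le_mul_of_nonneg_left h2 (by positivity)
    _ = 2 * d * 3 ^ d * (n : ℝ) ^ d := by rw [mul_pow]; ring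

/-! ### §3. The finite-size inequality for `θ_n(p) = P_p(0 ↔ ∂Λ_n)` (Moore–Shannon / CCFS integrated) -/

/-- **`√θ_n` is Lipschitz at scale `√#E(Λ_n)`**: for `0 < q ≤ p < 1`,
`√θ_n(p) ≤ √θ_n(q) + ((p − q)/2) · √( #E(Λ_n) / (q(1 − p)) )`.  Grimmett's Thm. (2.36)(a)
(`exists_hasDerivAt_real_le_sqrt`: `θ_n' ≤ √(#E θ_n(1−θ_n)/(r(1−r)))`) integrated by
`sqrt_le_sqrt_add_of_deriv_le`, using `r(1 − r) ≥ q(1 − p)` on `[q, p]`.  New as stated (a corollary of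
the printed inequality). -/
theorem sqrt_thetaN_le (d n : ℕ) {q p : ℝ} (hq : 0 < q) (hqp : q ≤ p) (hp : p < 1) :
    Real.sqrt (DCT16.thetaN d n p) ≤ Real.sqrt (DCT16.thetaN d n q) +
      Real.sqrt (((box d n).sym2.filter (· ∈ (zdGraph d).edgeSet)).card / (q * (1 - p))) / 2 * (p - q) := by
  classical
  set M : ℝ := Real.sqrt (((box d n).sym2.filter (· ∈ (zdGraph d).edgeSet)).card / (q * (1 - p))) with hM
  have hqp' : 0 < q * (1 - p) := mul_pos hq (by linarith)
  refine sqrt_le_sqrt_add_of_deriv_le hqp (Real.sqrt_nonneg _)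
    (DCT16.continuous_thetaN d n).continuousOn (fun x _ => (DCT16.thetaN_mem_Icc d n x).1) ?_
  intro r hr
  have hr01 : r ∈ Ioo (0 : ℝ) 1 := ⟨hq.trans hr.1, hr.2.trans hp⟩
  obtain ⟨D, hD, hDle⟩ := exists_hasDerivAt_real_le_sqrt (zdGraph d)
    (DCT16.isUpperSet_siteToBoundary d n) ((box d n).sym2) (DCT16.determinedBy_siteToBoundary d n) r hr01
  refine ⟨D, hD, hDle.trans ?_⟩
  -- `√(E θ(1-θ)/(r(1-r))) ≤ √(E/(q(1-p))) √θ`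
  set θ := DCT16.thetaN d n r with hθ
  have hθ' : (bondPercolation (zdGraph d) (projIcc 0 1 zero_le_one r)).real (siteToBoundary d n) = θ := rfl
  have hθ0 : 0 ≤ θ := (DCT16.thetaN_mem_Icc d n r).1
  have hθ1 : θ ≤ 1 := (DCT16.thetaN_mem_Icc d n r).2
  rw [hθ', hM, ← Real.sqrt_mul (div_nonneg (Nat.cast_nonneg _) hqp'.le)]
  apply Real.sqrt_le_sqrt
  have hrr : q * (1 - p) ≤ r * (1 - r) := by nlinarith [hr.1, hr.2]
  have hrr0 : 0 < r * (1 - r) := hqp'.trans_le hrr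
  rw [div_le_iff₀ hrr0]
  calc (((box d n).sym2.filter (· ∈ (zdGraph d).edgeSet)).card : ℝ) * (θ * (1 - θ))
      ≤ (((box d n).sym2.filter (· ∈ (zdGraph d).edgeSet)).card : ℝ) * θ := by
        apply mul_le_mul_of_nonneg_left _ (Nat.cast_nonneg _); nlinarith
    _ = ((box d n).sym2.filter (· ∈ (zdGraph d).edgeSet)).card / (q * (1 - p)) * θ * (q * (1 - p)) := by
        rw [div_mul_eq_mul_div, div_mul_cancel₀ _ hqp'.ne']
    _ ≤ ((box d n).sym2.filter (· ∈ (zdGraph d).edgeSet)).card / (q * (1 - p)) * θ * (r * (1 - r)) :=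
        mul_le_mul_of_nonneg_left hrr (mul_nonneg (div_nonneg (Nat.cast_nonneg _) hqp'.le) hθ0)

/-! ### §4. `θ(p)` against the one-arm probability `π_q(n) = P_q(0 ↔ ∂Λ_n)` at a smaller parameter -/

/-- **`θ` against the one-arm probability at a lower density.**  For `0 < q ≤ p < 1` and every `n`:
`θ(p) ≤ ( √π_q(n) + ((p − q)/2) · √( #E(Λ_n) / (q(1 − p)) ) )²`
(`θ(p) ≤ π_p(n)` is `DCT16.theta_le_real_siteToBoundary`; then `sqrt_thetaN_le`).  New. -/
theorem theta_le_sq_sqrt_oneArm_add (d n : ℕ) (q p : unitInterval) (hq : 0 < (q : ℝ))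
    (hqp : (q : ℝ) ≤ p) (hp : (p : ℝ) < 1) :
    theta (zdGraph d) 0 p ≤ (Real.sqrt (oneArmProb d q n) +
      Real.sqrt (((box d n).sym2.filter (· ∈ (zdGraph d).edgeSet)).card / ((q : ℝ) * (1 - p))) / 2 * ((p : ℝ) - q)) ^ 2 := by
  have h1 : theta (zdGraph d) 0 p ≤ DCT16.thetaN d n p := by
    rw [DCT16.thetaN_coe]; exact DCT16.theta_le_real_siteToBoundary p n
  have h2 := sqrt_thetaN_le d n hq hqp hp
  have hq' : DCT16.thetaN d n q = oneArmProb d q n := by rw [DCT16.thetaN_coe]; rfl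
  rw [hq'] at h2
  have h0 : 0 ≤ DCT16.thetaN d n p := (DCT16.thetaN_mem_Icc d n p).1
  calc theta (zdGraph d) 0 p ≤ DCT16.thetaN d n p := h1
    _ = (Real.sqrt (DCT16.thetaN d n p)) ^ 2 := (Real.sq_sqrt h0).symm
    _ ≤ _ := pow_le_pow_left₀ (Real.sqrt_nonneg _) h2 2

/-! ### §5. At `p_c`: the modulus of continuity and its vanishing (uses p205010) -/

/-- **One scale of the critical modulus.**  For `d ≥ 2`, `p_c ≤ p ≤ (1 + p_c)/2` and every `n`:
`θ(p) ≤ ( √π_{p_c}(n) + (p − p_c) · √( #E(Λ_n) / (2 p_c (1 − p_c)) ) )²`, i.e. `θ(p) ≤ ω_{d,n}(p − p_c)`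
with an explicit quadratic `ω_{d,n}` whose constant term is the critical one-arm probability at scale `n`.
(`0 < p_c < 1` on `ℤ^d`, `d ≥ 2`, are tree theorems.)  New. -/
theorem theta_le_sq_sqrt_oneArm_critical (hd : 2 ≤ d) (p : unitInterval)
    (hpc : (criticalProbI d : ℝ) ≤ p) (hp : (p : ℝ) ≤ (1 + criticalProbI d) / 2) (n : ℕ) :
    theta (zdGraph d) 0 p ≤ (Real.sqrt (oneArmProb d (criticalProbI d) n) +
      ((p : ℝ) - criticalProbI d) *
        Real.sqrt (((box d n).sym2.filter (· ∈ (zdGraph d).edgeSet)).card / (2 * (criticalProbI d : ℝ) * (1 - criticalProbI d)))) ^ 2 := by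
  have hpc0 : 0 < (criticalProbI d : ℝ) := by
    rw [coe_criticalProbI]; exact criticalProb_zd_pos d (by omega)
  have hpc1 : (criticalProbI d : ℝ) < 1 := by
    rw [coe_criticalProbI]; exact criticalProb_zd_lt_one hd
  have hp1 : (p : ℝ) < 1 := by linarith
  refine (theta_le_sq_sqrt_oneArm_add d n (criticalProbI d) p hpc0 hpc hp1).trans ?_
  have hs : 0 ≤ (p : ℝ) - criticalProbI d := by linarith
  have hE : 0 ≤ (((box d n).sym2.filter (· ∈ (zdGraph d).edgeSet)).card : ℝ) := Nat.cast_nonneg _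
  set A := Real.sqrt (((box d n).sym2.filter (· ∈ (zdGraph d).edgeSet)).card / ((criticalProbI d : ℝ) * (1 - p))) with hA
  set B := Real.sqrt (((box d n).sym2.filter (· ∈ (zdGraph d).edgeSet)).card / (2 * (criticalProbI d : ℝ) * (1 - criticalProbI d))) with hB
  -- `A ≤ 2 B` since `1 - p ≥ (1 - p_c)/2`
  have hAB : A ≤ 2 * B := by
    have h4 : Real.sqrt 4 = 2 := by
      rw [show (4 : ℝ) = 2 ^ 2 by norm_num, Real.sqrt_sq (by norm_num : (0 : ℝ) ≤ 2)]
    have hden1 : 0 < (criticalProbI d : ℝ) * (1 - p) := mul_pos hpc0 (by linarith)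
    have hden2 : 0 < 2 * (criticalProbI d : ℝ) * (1 - criticalProbI d) := by nlinarith
    have hcmp : 2 * (criticalProbI d : ℝ) * (1 - criticalProbI d) ≤
        4 * ((criticalProbI d : ℝ) * (1 - p)) := by nlinarith
    have hfrac : (((box d n).sym2.filter (· ∈ (zdGraph d).edgeSet)).card : ℝ) / ((criticalProbI d : ℝ) * (1 - p)) ≤
        4 * ((((box d n).sym2.filter (· ∈ (zdGraph d).edgeSet)).card : ℝ) / (2 * (criticalProbI d : ℝ) * (1 - criticalProbI d))) := by
      rw [mul_div_assoc', div_le_div_iff₀ hden1 hden2]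
      calc (((box d n).sym2.filter (· ∈ (zdGraph d).edgeSet)).card : ℝ) * (2 * (criticalProbI d : ℝ) * (1 - criticalProbI d))
          ≤ (((box d n).sym2.filter (· ∈ (zdGraph d).edgeSet)).card : ℝ) * (4 * ((criticalProbI d : ℝ) * (1 - p))) :=
            mul_le_mul_of_nonneg_left hcmp hE
        _ = 4 * ((box d n).sym2.filter (· ∈ (zdGraph d).edgeSet)).card * ((criticalProbI d : ℝ) * (1 - p)) := by ring
    calc A ≤ Real.sqrt (4 * ((((box d n).sym2.filter (· ∈ (zdGraph d).edgeSet)).card : ℝ) /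
          (2 * (criticalProbI d : ℝ) * (1 - criticalProbI d)))) := Real.sqrt_le_sqrt hfrac
      _ = 2 * B := by rw [Real.sqrt_mul (by norm_num : (0 : ℝ) ≤ 4), h4]
  have hle : Real.sqrt (oneArmProb d (criticalProbI d) n) + A / 2 * ((p : ℝ) - criticalProbI d) ≤
      Real.sqrt (oneArmProb d (criticalProbI d) n) + ((p : ℝ) - criticalProbI d) * B := by
    nlinarith [Real.sqrt_nonneg (((box d n).sym2.filter (· ∈ (zdGraph d).edgeSet)).card / (2 * (criticalProbI d : ℝ) * (1 - criticalProbI d)))]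
  have hnn : 0 ≤ Real.sqrt (oneArmProb d (criticalProbI d) n) + A / 2 * ((p : ℝ) - criticalProbI d) := by
    have := Real.sqrt_nonneg (((box d n).sym2.filter (· ∈ (zdGraph d).edgeSet)).card / ((criticalProbI d : ℝ) * (1 - p)))
    positivity
  exact pow_le_pow_left₀ hnn hle 2

/-- **The modulus form**: for `d ≥ 2` and `p_c ≤ p ≤ (1 + p_c)/2`,
`θ(p) ≤ ω_d(p − p_c)`, `ω_d(t) := inf_n ( √π_{p_c}(n) + t · √( #E(Λ_n)/(2 p_c (1 − p_c)) ) )²` — a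
modulus of continuity of `θ` at `p_c⁺` which is explicit modulo the critical one-arm sequence
`π_{p_c}(n)`.  New. -/
theorem theta_le_ciInf_critical (hd : 2 ≤ d) (p : unitInterval)
    (hpc : (criticalProbI d : ℝ) ≤ p) (hp : (p : ℝ) ≤ (1 + criticalProbI d) / 2) :
    theta (zdGraph d) 0 p ≤ ⨅ n : ℕ, (Real.sqrt (oneArmProb d (criticalProbI d) n) +
      ((p : ℝ) - criticalProbI d) *
        Real.sqrt (((box d n).sym2.filter (· ∈ (zdGraph d).edgeSet)).card / (2 * (criticalProbI d : ℝ) * (1 - criticalProbI d)))) ^ 2 :=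
  le_ciInf fun n => theta_le_sq_sqrt_oneArm_critical hd p hpc hp n

/-- There are critical one-arm probabilities below any positive level: `∀ b > 0, ∃ n, π_{p_c}(n) < b`.
This is exactly `θ(p_c) = 0` (p205010, `CSH.percolationContinuity_allDimensions`) read through
`θ(p_c) = inf_n π_{p_c}(n)`.
builds on p205010 (kernel theorem, internal audit signed; external expert review pending). -/
theorem exists_oneArmProb_critical_lt (hd : 2 ≤ d) {b : ℝ} (hb : 0 < b) :
    ∃ n : ℕ, oneArmProb d (criticalProbI d) n < b := by
  by_contra h
  push Not at h
  have hle := DCT16.le_theta_of_forall_le_real_siteToBoundary (d := d) (criticalProbI d) (c := b)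
    (fun n => h n)
  have h0 : theta (zdGraph d) 0 (criticalProbI d) = 0 := CSH.percolationContinuity_allDimensions d hd
  linarith

/-- **The modulus vanishes at `0`**: `ω_d(t) → 0` as `t → 0` (hence `θ(p) → 0 = θ(p_c)` as `p ↓ p_c`,
with the explicit control `θ(p) ≤ ω_d(p − p_c)` of `theta_le_ciInf_critical`).  The one non-explicit
ingredient is `inf_n π_{p_c}(n) = θ(p_c) = 0`, i.e. p205010; any explicit rate for `π_{p_c}(n)` makes
`ω_d` explicit (`theta_le_rpow_of_oneArmDecay`).
builds on p205010 (kernel theorem, internal audit signed; external expert review pending). -/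
theorem tendsto_ciInf_critical (hd : 2 ≤ d) :
    Tendsto (fun t : ℝ => ⨅ n : ℕ, (Real.sqrt (oneArmProb d (criticalProbI d) n) +
      t * Real.sqrt (((box d n).sym2.filter (· ∈ (zdGraph d).edgeSet)).card / (2 * (criticalProbI d : ℝ) * (1 - criticalProbI d)))) ^ 2)
      (𝓝 0) (𝓝 0) := by
  set K : ℕ → ℝ := fun n =>
    Real.sqrt (((box d n).sym2.filter (· ∈ (zdGraph d).edgeSet)).card / (2 * (criticalProbI d : ℝ) * (1 - criticalProbI d))) with hK
  set f : ℕ → ℝ → ℝ := fun n t => (Real.sqrt (oneArmProb d (criticalProbI d) n) + t * K n) ^ 2 with hf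
  have hf0 : ∀ n t, 0 ≤ f n t := fun n t => sq_nonneg _
  have hbdd : ∀ t, BddBelow (Set.range fun n => f n t) := fun t =>
    ⟨0, by rintro _ ⟨n, rfl⟩; exact hf0 n t⟩
  show Tendsto (fun t => ⨅ n, f n t) (𝓝 0) (𝓝 0)
  rw [tendsto_order]
  refine ⟨fun a ha => Eventually.of_forall fun t => lt_of_lt_of_le ha (le_ciInf fun n => hf0 n t),
    fun b hb => ?_⟩
  obtain ⟨n, hn⟩ := exists_oneArmProb_critical_lt hd hb
  have hcont : Continuous (f n) := by
    simp only [hf]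
    fun_prop
  have hfn0 : f n 0 = oneArmProb d (criticalProbI d) n := by
    simp only [hf, zero_mul, add_zero]
    exact Real.sq_sqrt measureReal_nonneg
  have hev : ∀ᶠ t in 𝓝 (0 : ℝ), f n t < b := by
    have hlim : Tendsto (f n) (𝓝 0) (𝓝 (f n 0)) := hcont.tendsto 0
    exact hlim.eventually (eventually_lt_nhds (by rw [hfn0]; exact hn))
  exact hev.mono fun t ht => lt_of_le_of_lt (ciInf_le (hbdd t) n) ht

end ThetaModulus

end Summit.CriticalPhenomena.PercolationContinuityZ3.Theorems
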